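import Summits.Langlands.Langlands.Theses.ParityBlindBianchi
import Summits.Langlands.Langlands.Theorems.ParityBlindBianchiResidualBianchiDoorLevel
import Summits.Langlands.Langlands.Theorems.ParityBlindBianchiIcosahedralDescentLevelMain
import Summits.Langlands.Langlands.Theorems.ParityBlindBianchiIcosahedralDescentLevelOfBianchiArtin
import HarnessLib

/-!
# Skeleton (line `DoorFromOwnChain`, lead a1 v3 → lead c7 v4) for crux stmt-Langlands-15113 `IcosahedralDescentLevel`

Card: `Cruxes/IcosahedralDescentLevel/Ideas/door-from-own-chain.md` (crux-ideate r2 k4).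

v4 (lead c7, 2026-08-16): the transfer stub `stub_artinOfBianchiArtin` is now IMPORTED from the landed
`Theorems/ParityBlindBianchiIcosahedralDescentLevelOfBianchiArtin.lean` (p121513, accepted) and its `sorry`
dropped — 4 registered stubs remain open (3 named-fact bundles + `stub_bianchiArtin`); composition unchanged.

THE SHAPE.  The crux AS TYPED is, with no hypothesis, the all-parity door
`GaloisWeightedBE.StrongArtinIcosahedralQ` (stmt-Langlands-10841; `iff_strongArtinIcosahedralQ`, p116764),
at which line `Sketch` died (`Lines/Sketch-dead.md`: base change / descent cannot CREATE automorphy of an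
insoluble-image `ρ`).  This line DISCHARGES the door from the route's own parity-free chain.  v3 RESHAPE
(same composition idea, sharper stub set): the two crux stubs of v1/v2 (`stub_E2 ≡ TwoAdicBianchiProModularityLevel`,
`stub_R ≡ ArtinWeightRealisationLevel`, verbatim the items stmt-Langlands-15110 / 15111) were consumed only
JOINTLY and only at ONE instance — `p = 2`, `σ = σ₀|_{Γ_K}` the restriction of a 2-adic representation of
`Γ_ℚ`, a PRIME-ONLY bad set `S ∋ 2` — so they are replaced by the single stub `stub_bianchiArtin` stating
exactly that instance of E2′ ∘ R′ (implied by stmt-15110 ∧ stmt-15111: `bianchiArtin_of_thesis`, landed with the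
transfer).  Registered stubs:

* three NAMED-FACT stubs (printed theorems filed as named facts of the tree, undischarged, Literature debt
  queue; a lookup wave of stub workers confirmed none is dischargeable from the tree today):
  `stub_fact_khareWintenberger` (Khare–Wintenberger 2009 (I) Thm 1.2 + 9.1 with Kisin 2009, all `p`; used at
  `p = 2`), `stub_fact_baseChangeLifting` (Arthur–Clozel Ch. 3 Thm 4.2 (a) + Thm 5.1: four tree names),
  `stub_fact_descentFibres` (Arthur–Clozel Ch. 3 Thm 4.2 (d) + Thm 3.1: two tree names);
* ONE crux stub `stub_bianchiArtin` — OPEN PROBLEM (even case = even icosahedral Artin; odd case in print),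
  the route's thesis X = E2′ ∧ R′ at the consumed instance; NOT for stub workers of this line (it follows
  from the items stmt-Langlands-15110 and stmt-Langlands-15111, which have their own line chains, by
  `bianchiArtin_of_thesis`);
* the TRANSFER `stub_artinOfBianchiArtin` — seven facts → `stub_bianchiArtin` → a.e. strong Artin for EVERY
  irreducible icosahedral `ρ/ℚ` (the conclusion of the typed crux; its hypothesis is dropped) — LANDED
  (`Theorems/ParityBlindBianchiIcosahedralDescentLevelOfBianchiArtin.lean`, p121513; v1's `stub_doorFromThesis`
  likewise in `Theorems/ParityBlindBianchiIcosahedralDescentLevelOfThesis.lean`, p121025) and IMPORTED here (v4).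

`IcosahedralDescentLevel_of` concludes the crux BY NAME from the registered stubs and nothing else.
Disproof.lean used: §1 `door_of_icosahedralDescentLevel` (any proof of D′ proves the door — honoured: the
door is the line's theorem), §1 `uniformFamily_of_zero_mem` (the `S₀ = {0}` degeneration — avoided: the crux
hypothesis is never used; `S` is prime-only from `stub_qLevel`), §5 `descent_of_allParity` (same shape, with
all-parity Artin PROVED from the thesis instead of assumed).
-/

-- `Summit.Langlands.Langlands.…`: the repeated path component is the tree's layout (D-0017).
set_option linter.dupNamespace false

noncomputable section

open scoped MatrixGroups NumberField Polynomial Classical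
open NumberField IsDedekindDomain Field Filter
open Literature.NumberTheory.Automorphic Literature.NumberTheory.GaloisRepresentations
open Summit.Langlands.Langlands.Theses.ParityBlindBianchi

namespace Summit.Langlands.Langlands.Theorems.IcosahedralDescentLevel

/-! ### Named-fact stubs (XL printed theorems of the tree; Literature debt, NOT worked by this line) -/

/-- STUB-FACT (Khare–Wintenberger–Kisin): Serre's modularity conjecture in the tree's form
`khare_wintenberger p k`, for every prime `p` and every discrete field `k` (only `p = 2` is consumed, by
`stub_qLevel`).  Undischarged named fact of the tree (no `_holds`, not even at `p = 2`).
[cite: KhareWintenberger2009, Thm. 1.2] -/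
theorem stub_fact_khareWintenberger :
    ∀ (p : ℕ) [Fact p.Prime] (k : Type) [Field k] [TopologicalSpace k] [DiscreteTopology k],
      khare_wintenberger p k := by
  sorry

/-- STUB-FACT (Arthur–Clozel, cyclic base change of prime degree for `GL_n`): cuspidality of the base
change (`baseChange_cyclic_cuspidal`, Ch. 3 Thm 4.2 (a)) and strong lifting at the archimedean, at all
finite and at the unramified places (`ArthurClozel1989_strongLifting_archimedean`, `…_allFinite`,
`…_unramified`, Ch. 3 Thm 5.1 with (1.1)) — four named facts of the tree, undischarged (in the tree only
the rank-0/1 instances and reductions to `ArthurClozel1989_weakLifting_cuspidal`, `multiplicity_one_gl`,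
Jacquet–Shalika (2.2)/(2.3) in general rank). [cite: ArthurClozelAMS120, Ch. 3 Thm. 4.2 (a), Thm. 5.1] -/
theorem stub_fact_baseChangeLifting :
    baseChange_cyclic_cuspidal ∧ ArthurClozel1989_strongLifting_archimedean ∧
      ArthurClozel1989_strongLifting_allFinite ∧ ArthurClozel1989_strongLifting_unramified := by
  sorry

/-- STUB-FACT (Arthur–Clozel, descent and fibres): cyclic descent of prime degree
(`cuspidal_descent_cyclic`, Ch. 3 Thm 4.2 (d)) and the fibres of quadratic base change
(`ArthurClozel_fibres_quadratic`, Ch. 3 Thm 3.1) — two named facts of the tree, undischarged (reductions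
`cuspidal_descent_cyclic_of_leaves`, `ArthurClozel_fibres_quadratic_of_leaves'` wait on
`ArthurClozel1989_exists_cuspidal_descent_of_isGalStable`, `multiplicity_one_gl` and the Jacquet–Shalika
leaves in general rank). [cite: ArthurClozelAMS120, Ch. 3 Thm. 4.2 (d), Thm. 3.1] -/
theorem stub_fact_descentFibres : cuspidal_descent_cyclic ∧ ArthurClozel_fibres_quadratic := by
  sorry

/-! ### The crux stub: the route's thesis X = E2′ ∧ R′ at the ONE instance the chain consumes -/

/-- STUB-CRUX (OPEN PROBLEM; ≡ E2′ ∘ R′ at `p = 2` on restrictions `σ₀|_{Γ_K}` with a prime-only bad set;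
implied by the items stmt-Langlands-15110 ∧ stmt-Langlands-15111 — `bianchiArtin_of_thesis` — and driven by
THEIR line chains, not by stub workers of this line).  For every imaginary quadratic `K` with `2` split,
every `ι : ℚ̄₂ ≃+* ℂ`, every 2-adic `σ₀ : Γ_ℚ → GL₂(ℚ̄₂)` whose restriction to `Γ_K` has finite image, is
irreducible and projectively `A₅`, and every finite set of PRIMES `S ∋ 2`: if some regular algebraic
cuspidal `π₀` of `GL₂(𝔸_K)` is congruent to `σ₀|_{Γ_K}` at every place of `K` over no prime of `S` (the
residual rung, in the HLTT arithmetic normalisation), then some cuspidal `π` of `GL₂(𝔸_K)` is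
Satake–Frobenius compatible with `σ₀|_{Γ_K}` at every such place.  Even `ρ`: the open even-icosahedral
sector; odd `ρ`: in print (KW + Kisin + weight one, base-changed). [folklore] -/
theorem stub_bianchiArtin :
    ∀ (K : Type) [Field K] [NumberField K], NumberField.IsTotallyComplex K → Module.finrank ℚ K = 2 →
      (∃ v w : HeightOneSpectrum (𝓞 K), v ≠ w ∧ ((2 : ℕ) : 𝓞 K) ∈ v.asIdeal ∧ ((2 : ℕ) : 𝓞 K) ∈ w.asIdeal) →
      ∀ (ι : PadicAlgCl 2 ≃+* ℂ) (σ₀ : FramedGaloisRep ℚ (PadicAlgCl 2) 2),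
        Finite (σ₀.restrictField K).toMonoidHom.range →
        (σ₀.restrictField K).toGaloisRep.IsIrreducible →
        Nonempty ((Matrix.ProjGenLinGroup.mk.comp (σ₀.restrictField K).toMonoidHom).range ≃*
          alternatingGroup (Fin 5)) →
        ∀ S : Finset ℕ, 2 ∈ S → (∀ ℓ ∈ S, ℓ.Prime) →
          (∃ (hcpt : isCompact_glFiniteIntegralLevel 2 K) (π₀ : CuspidalAutomorphicRepData 2 K hcpt),
              π₀.1.IsRegularAlgebraic ∧
                ∀ v : HeightOneSpectrum (𝓞 K), (∀ ℓ ∈ S, ((ℓ : ℕ) : 𝓞 K) ∉ v.asIdeal) →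
                  ∃ (α : Multiset ℂ) (P : Polynomial (PadicAlgCl 2)), π₀.1.HasSatakeParamAt v α ∧
                    (σ₀.restrictField K).IsUnramifiedAt v ∧ (σ₀.restrictField K).HasFrobCharpolyAt v P ∧
                      ∀ i : ℕ, ‖P.coeff i - (arithFrobPolyOfSatake ι v.residueCard 2 α).coeff i‖ < 1) →
          ∃ (hcpt : isCompact_glFiniteIntegralLevel 2 K) (π : CuspidalAutomorphicRepData 2 K hcpt),
            ∀ w : HeightOneSpectrum (𝓞 K), (∀ ℓ ∈ S, ((ℓ : ℕ) : 𝓞 K) ∉ w.asIdeal) →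
              Summit.Langlands.SatakeFrobCompatibleAt ι π.1 (σ₀.restrictField K) w := by
  sorry

/-! ### Transfer (LANDED: `stub_artinOfBianchiArtin`, p121513 — imported, no longer a stub)

`Summit.Langlands.Langlands.Theorems.IcosahedralDescentLevel.stub_artinOfBianchiArtin`
(`Theorems/ParityBlindBianchiIcosahedralDescentLevelOfBianchiArtin.lean`): the seven printed named facts and
`stub_bianchiArtin` imply a.e. strong Artin for every irreducible icosahedral `ρ/ℚ`, odd or even —
`stub_qLevel` (E1′ over `ℚ`, PRIME-ONLY `S ∋ 2`), per 2-split `K` `exists_padicModel_restrictField` +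
`stub_cuspWitness` + `stub_bcTransfer`, then `stub_bianchiArtin`, then the landed repaired descent
`icosahedralDescentLevel_repaired` (D″, p111861, `0 ∉ S` by primality). -/

/-! ### Composition -/

/-- **Skeleton conclusion.**  `IcosahedralDescentLevel` AS TYPED from the registered stubs only: its
conclusion for `(ι, ρ)` is the LANDED transfer `stub_artinOfBianchiArtin` (p121513) fed with the three
named-fact stubs and the one crux stub; its uniform-family hypothesis (vacuous at `S₀ = {0}`,
Disproof.lean §1) is discarded. [folklore] -/
theorem IcosahedralDescentLevel_of : IcosahedralDescentLevel :=
  fun ι ρ hirr hA5 _ =>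
    stub_artinOfBianchiArtin stub_fact_khareWintenberger stub_fact_baseChangeLifting.1
      stub_fact_baseChangeLifting.2.1 stub_fact_baseChangeLifting.2.2.1 stub_fact_descentFibres.1
      stub_fact_baseChangeLifting.2.2.2 stub_fact_descentFibres.2 stub_bianchiArtin ι ρ hirr hA5

end Summit.Langlands.Langlands.Theorems.IcosahedralDescentLevel

end
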